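import Mathlib
import Summits.NavierStokesRegularity.NavierStokesRegularity.Theorems.PlaneEnergyCeilingPlanarEnergyAPrioriPlanarAgmon

/-!
# Route PlaneEnergyCeiling · crux `PlanarEnergyAPriori` — slice-wise Ladyzhenskaya inequality

Helper file for the crux item stmt-NavierStokesRegularity-16855 (`PlanarEnergyAPriori`), landed
`--supports` that item: the first input of the FLUX VARIATION BOUND
`osc_c F(R,·) ≤ C √(sup_c E(R,c)) ‖∇u‖₂²` (strategist census gen 1, A-S6 (F1)). The `L⁴` norm of a
field is controlled by its PLANAR CEILING in one direction and its gradient,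
`∫_{ℝ³} ‖w‖⁴ ≤ (sup_c ∫_{R({x₂=c})} ‖w‖²) · ∫_{ℝ³} ‖Dw‖²`, uniformly in the direction `R`
(Ladyzhenskaya's planar inequality on every plane of the foliation, integrated in the offset).

* `lintegral_enorm_pow_four_le_lintegral_mul_lintegral` — LADYZHENSKAYA ON `ℝ²`, product form
  `∫ ‖g‖⁴ ≤ (∫ ‖g‖ ‖∂₀g‖)(∫ ‖g‖ ‖∂₁g‖)` for `g ∈ C¹(ℝ²; F)` with `∫ ‖g‖² < ∞` (no compact support:
  1-D Agmon `enorm_sq_le_lintegral_enorm_mul_enorm_deriv` on a.e. horizontal and vertical line,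
  `‖g(a,b)‖⁴ ≤ A(b)B(a)`, Tonelli through the chart `ℝ × ℝ ≃ᵐ ℝ²`);
* `lintegral_enorm_pow_four_le_lintegral_sq_mul_lintegral_fderiv_sq` — the Cauchy–Schwarz form
  `∫ ‖g‖⁴ ≤ (∫ ‖g‖²)(∫ ‖Dg‖²)`;
* `lintegral_enorm_pow_four_le_iSup_planarEnergy_mul` — the SLICE-WISE INEQUALITY ON `ℝ³`
  (registered sub-goal of stmt-16855; Tonelli along the foliation, the planar inequality on a.e.
  plane, `‖D(w ∘ R ∘ P(·,c))‖ ≤ ‖Dw‖` for the isometric parametrisation `P(y,c) = (y₀,y₁,c)`).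
Folklore (Ladyzhenskaya 1959, Lemma 1), constant `1` in the product form.
-/

noncomputable section

-- single-conjunct summit: `Summit.<Summit>.<Problem>` repeats the name by the D-0017 layout
set_option linter.dupNamespace false

namespace Summit.NavierStokesRegularity.NavierStokesRegularity.Theorems.PlanarEnergyAPriori

open MeasureTheory Set Filter Topology WithLp
open scoped ENNReal RealInnerProductSpace
open Summit.NavierStokesRegularity.NavierStokesRegularity.Theorems.PlaneEnergyCeilingSlabEnergyIdentity

/-! ### Lines in the plane and the chart `ℝ × ℝ ≃ᵐ ℝ²` -/

/-- The horizontal line at height `b`: `(s, b) = (0, b) + s e₀`. -/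
theorem toLp_vec2_eq_add_smul_fst (s b : ℝ) :
    (toLp 2 ![s, b] : EuclideanSpace ℝ (Fin 2)) = toLp 2 ![0, b] + s • EuclideanSpace.single 0 1 := by
  ext k; fin_cases k <;> simp

/-- The vertical line at abscissa `a`: `(a, s) = (a, 0) + s e₁`. -/
theorem toLp_vec2_eq_add_smul_snd (a s : ℝ) :
    (toLp 2 ![a, s] : EuclideanSpace ℝ (Fin 2)) = toLp 2 ![a, 0] + s • EuclideanSpace.single 1 1 := by
  ext k; fin_cases k <;> simp

/-- The horizontal line `s ↦ (s, b)` has velocity `e₀`. -/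
theorem hasDerivAt_toLp_vec2_fst (b s : ℝ) :
    HasDerivAt (fun s : ℝ => (toLp 2 ![s, b] : EuclideanSpace ℝ (Fin 2))) (EuclideanSpace.single 0 1) s := by
  have h := ((hasDerivAt_id s).smul_const (EuclideanSpace.single (0 : Fin 2) (1 : ℝ))).const_add
    (toLp 2 ![0, b] : EuclideanSpace ℝ (Fin 2))
  simp only [id_eq, one_smul] at h
  have hfun : (fun s : ℝ => (toLp 2 ![s, b] : EuclideanSpace ℝ (Fin 2))) =
      fun s => toLp 2 ![0, b] + s • EuclideanSpace.single 0 1 :=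
    funext fun s' => toLp_vec2_eq_add_smul_fst s' b
  rw [hfun]; exact h

/-- The vertical line `s ↦ (a, s)` has velocity `e₁`. -/
theorem hasDerivAt_toLp_vec2_snd (a s : ℝ) :
    HasDerivAt (fun s : ℝ => (toLp 2 ![a, s] : EuclideanSpace ℝ (Fin 2))) (EuclideanSpace.single 1 1) s := by
  have h := ((hasDerivAt_id s).smul_const (EuclideanSpace.single (1 : Fin 2) (1 : ℝ))).const_add
    (toLp 2 ![a, 0] : EuclideanSpace ℝ (Fin 2))
  simp only [id_eq, one_smul] at h
  have hfun : (fun s : ℝ => (toLp 2 ![a, s] : EuclideanSpace ℝ (Fin 2))) =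
      fun s => toLp 2 ![a, 0] + s • EuclideanSpace.single 1 1 :=
    funext fun s' => toLp_vec2_eq_add_smul_snd a s'
  rw [hfun]; exact h

/-- **The plane chart.** A measurable equivalence `e : ℝ × ℝ ≃ᵐ ℝ²` with `e (a, b) = (a, b)`
preserving Lebesgue measure (`toLp ∘ finTwoArrow⁻¹`). -/
theorem exists_planeChart : ∃ e : ℝ × ℝ ≃ᵐ EuclideanSpace ℝ (Fin 2), MeasurePreserving e volume volume ∧
    ∀ a b : ℝ, e (a, b) = toLp 2 ![a, b] := by
  refine ⟨(MeasurableEquiv.finTwoArrow (α := ℝ)).symm.trans (MeasurableEquiv.toLp 2 (Fin 2 → ℝ)), ?_, ?_⟩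
  · exact (volume_preserving_finTwoArrow ℝ).symm.trans (PiLp.volume_preserving_toLp (Fin 2))
  · intro a b; ext k; fin_cases k <;> rfl

/-! ### Ladyzhenskaya's inequality on `ℝ²` -/

section TwoDim

variable {F : Type*} [NormedAddCommGroup F] [InnerProductSpace ℝ F]

/-- **Ladyzhenskaya's inequality on `ℝ²`, product form** (sharp, constant `1`): for
`g ∈ C¹(ℝ²; F)` with `∫ ‖g‖² < ∞`,
`∫ ‖g‖⁴ ≤ (∫ ‖g‖ ‖Dg e₀‖) · (∫ ‖g‖ ‖Dg e₁‖)`.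
(Agmon on a.e. horizontal and a.e. vertical line, `‖g(a,b)‖⁴ ≤ A(b)·B(a)`, then Tonelli.)
[folklore: Ladyzhenskaya 1959, Lemma 1] -/
theorem lintegral_enorm_pow_four_le_lintegral_mul_lintegral {g : EuclideanSpace ℝ (Fin 2) → F}
    (hg : ContDiff ℝ 1 g) (hL2 : ∫⁻ y, ‖g y‖ₑ ^ 2 < ∞) :
    ∫⁻ y, ‖g y‖ₑ ^ 4 ≤ (∫⁻ y, ‖g y‖ₑ * ‖fderiv ℝ g y (EuclideanSpace.single 0 1)‖ₑ) *
      ∫⁻ y, ‖g y‖ₑ * ‖fderiv ℝ g y (EuclideanSpace.single 1 1)‖ₑ := by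
  obtain ⟨e, he, heq⟩ := exists_planeChart
  have hgc : Continuous g := hg.continuous
  have hdiff : Differentiable ℝ g := hg.differentiable one_ne_zero
  have hd0 : Continuous fun y => fderiv ℝ g y (EuclideanSpace.single 0 1) := (hg.continuous_fderiv one_ne_zero).clm_apply continuous_const
  have hd1 : Continuous fun y => fderiv ℝ g y (EuclideanSpace.single 1 1) := (hg.continuous_fderiv one_ne_zero).clm_apply continuous_const
  have heq' : ∀ z : ℝ × ℝ, e z = toLp 2 ![z.1, z.2] := fun z => heq z.1 z.2
  -- the densities, read on `ℝ × ℝ`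
  set f : ℝ × ℝ → ℝ≥0∞ := fun z => ‖g (e z)‖ₑ with hf
  set D0 : ℝ × ℝ → ℝ≥0∞ := fun z => ‖fderiv ℝ g (e z) (EuclideanSpace.single 0 1)‖ₑ with hD0
  set D1 : ℝ × ℝ → ℝ≥0∞ := fun z => ‖fderiv ℝ g (e z) (EuclideanSpace.single 1 1)‖ₑ with hD1
  have hm2 : Measurable fun y => ‖g y‖ₑ ^ 2 := (continuous_enorm.comp hgc).measurable.pow_const 2
  have hm4 : Measurable fun y => ‖g y‖ₑ ^ 4 := (continuous_enorm.comp hgc).measurable.pow_const 4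
  have hmg0 : Measurable fun y => ‖g y‖ₑ * ‖fderiv ℝ g y (EuclideanSpace.single 0 1)‖ₑ :=
    (continuous_enorm.comp hgc).measurable.mul (continuous_enorm.comp hd0).measurable
  have hmg1 : Measurable fun y => ‖g y‖ₑ * ‖fderiv ℝ g y (EuclideanSpace.single 1 1)‖ₑ :=
    (continuous_enorm.comp hgc).measurable.mul (continuous_enorm.comp hd1).measurable
  have hfm : Measurable f := (continuous_enorm.comp hgc).measurable.comp e.measurable
  have hD0m : Measurable D0 := (continuous_enorm.comp hd0).measurable.comp e.measurable
  have hD1m : Measurable D1 := (continuous_enorm.comp hd1).measurable.comp e.measurable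
  have hf2m : Measurable fun z => f z ^ 2 := hfm.pow_const 2
  -- the two line functionals
  set A : ℝ → ℝ≥0∞ := fun b => ∫⁻ a, f (a, b) * D0 (a, b) with hA
  set B : ℝ → ℝ≥0∞ := fun a => ∫⁻ b, f (a, b) * D1 (a, b) with hB
  have hAm : Measurable A := (hfm.mul hD0m).lintegral_prod_left'
  have hBm : Measurable B := (hfm.mul hD1m).lintegral_prod_right'
  have hvol : (volume : Measure (ℝ × ℝ)) = (volume : Measure ℝ).prod volume := Measure.volume_eq_prod _ _
  -- the `L²` mass read on the product
  have hL2' : ∫⁻ z, f z ^ 2 ∂((volume : Measure ℝ).prod volume) < ∞ := by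
    rw [← hvol, hf]
    calc ∫⁻ z, ‖g (e z)‖ₑ ^ 2 = ∫⁻ y, ‖g y‖ₑ ^ 2 := he.lintegral_comp hm2
      _ < ∞ := hL2
  -- Agmon on the horizontal line at height `b`
  have hH : ∀ b, ∫⁻ a, f (a, b) ^ 2 < ∞ → ∀ a, f (a, b) ^ 2 ≤ A b := by
    intro b hb a
    have hlc : Continuous fun s : ℝ => (toLp 2 ![s, b] : EuclideanSpace ℝ (Fin 2)) :=
      continuous_iff_continuousAt.2 fun s => (hasDerivAt_toLp_vec2_fst b s).continuousAt
    have hl : ∀ s, HasDerivAt (fun s : ℝ => g (toLp 2 ![s, b]))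
        (fderiv ℝ g (toLp 2 ![s, b]) (EuclideanSpace.single 0 1)) s := fun s =>
      (hdiff _).hasFDerivAt.comp_hasDerivAt s (hasDerivAt_toLp_vec2_fst b s)
    have hb' : ∫⁻ s, ‖g (toLp 2 ![s, b])‖ₑ ^ 2 < ∞ := by simpa [hf, heq'] using hb
    have h1 := enorm_sq_le_lintegral_enorm_mul_enorm_deriv hl (hd0.comp hlc) hb' a
    simpa [hA, hf, hD0, heq'] using h1
  -- Agmon on the vertical line at abscissa `a`
  have hV : ∀ a, ∫⁻ b, f (a, b) ^ 2 < ∞ → ∀ b, f (a, b) ^ 2 ≤ B a := by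
    intro a ha b
    have hlc : Continuous fun s : ℝ => (toLp 2 ![a, s] : EuclideanSpace ℝ (Fin 2)) :=
      continuous_iff_continuousAt.2 fun s => (hasDerivAt_toLp_vec2_snd a s).continuousAt
    have hl : ∀ s, HasDerivAt (fun s : ℝ => g (toLp 2 ![a, s]))
        (fderiv ℝ g (toLp 2 ![a, s]) (EuclideanSpace.single 1 1)) s := fun s =>
      (hdiff _).hasFDerivAt.comp_hasDerivAt s (hasDerivAt_toLp_vec2_snd a s)
    have ha' : ∫⁻ s, ‖g (toLp 2 ![a, s])‖ₑ ^ 2 < ∞ := by simpa [hf, heq'] using ha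
    have h1 := enorm_sq_le_lintegral_enorm_mul_enorm_deriv hl (hd1.comp hlc) ha' b
    simpa [hB, hf, hD1, heq'] using h1
  -- almost every line carries finite `L²` mass
  have haeH : ∀ᵐ b : ℝ, ∫⁻ a, f (a, b) ^ 2 < ∞ := by
    refine ae_lt_top hf2m.lintegral_prod_left' ?_
    rw [← lintegral_prod_symm' _ hf2m]
    exact hL2'.ne
  have haeV : ∀ᵐ a : ℝ, ∫⁻ b, f (a, b) ^ 2 < ∞ := by
    refine ae_lt_top hf2m.lintegral_prod_right' ?_
    rw [← lintegral_prod _ hf2m.aemeasurable]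
    exact hL2'.ne
  have hae : ∀ᵐ z : ℝ × ℝ ∂((volume : Measure ℝ).prod volume), f z ^ 4 ≤ B z.1 * A z.2 := by
    filter_upwards [(Measure.quasiMeasurePreserving_snd (μ := (volume : Measure ℝ)) (ν := (volume : Measure ℝ))).ae haeH,
      (Measure.quasiMeasurePreserving_fst (μ := (volume : Measure ℝ)) (ν := (volume : Measure ℝ))).ae haeV]
      with z hz2 hz1
    have h1 := hH z.2 hz2 z.1
    have h2 := hV z.1 hz1 z.2
    calc f z ^ 4 = f (z.1, z.2) ^ 2 * f (z.1, z.2) ^ 2 := by rw [← pow_add]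
      _ ≤ B z.1 * A z.2 := by rw [mul_comm]; exact mul_le_mul' h1 h2 |>.trans_eq (mul_comm _ _)
  -- integrate
  calc ∫⁻ y, ‖g y‖ₑ ^ 4 = ∫⁻ z, f z ^ 4 := by rw [hf]; exact (he.lintegral_comp hm4).symm
    _ = ∫⁻ z, f z ^ 4 ∂((volume : Measure ℝ).prod volume) := by rw [hvol]
    _ ≤ ∫⁻ z, B z.1 * A z.2 ∂((volume : Measure ℝ).prod volume) := lintegral_mono_ae hae
    _ = (∫⁻ a, B a) * ∫⁻ b, A b := lintegral_prod_mul hBm.aemeasurable hAm.aemeasurable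
    _ = (∫⁻ z, f z * D1 z ∂((volume : Measure ℝ).prod volume)) *
          ∫⁻ z, f z * D0 z ∂((volume : Measure ℝ).prod volume) := by
        have hBi : ∫⁻ a, B a = ∫⁻ z, f z * D1 z ∂((volume : Measure ℝ).prod volume) := by
          rw [hB]; exact (lintegral_prod (fun z => f z * D1 z) (hfm.mul hD1m).aemeasurable).symm
        have hAi : ∫⁻ b, A b = ∫⁻ z, f z * D0 z ∂((volume : Measure ℝ).prod volume) := by
          rw [hA]; exact (lintegral_prod_symm' (fun z => f z * D0 z) (hfm.mul hD0m)).symm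
        rw [hBi, hAi]
    _ = (∫⁻ y, ‖g y‖ₑ * ‖fderiv ℝ g y (EuclideanSpace.single 1 1)‖ₑ) *
          ∫⁻ y, ‖g y‖ₑ * ‖fderiv ℝ g y (EuclideanSpace.single 0 1)‖ₑ := by
        rw [← hvol, hf, hD0, hD1]
        exact congrArg₂ (· * ·) (he.lintegral_comp hmg1) (he.lintegral_comp hmg0)
    _ = _ := mul_comm _ _


/-- One factor of the product form under Cauchy–Schwarz and `‖Dg v‖ ≤ ‖Dg‖` (`‖v‖ = 1`):
`∫ ‖g‖ ‖Dg eᵢ‖ ≤ (∫ ‖g‖²)^{1/2} (∫ ‖Dg‖²)^{1/2}`. -/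
theorem lintegral_enorm_mul_enorm_fderiv_apply_le {g : EuclideanSpace ℝ (Fin 2) → F} (hg : ContDiff ℝ 1 g)
    (i : Fin 2) :
    ∫⁻ y, ‖g y‖ₑ * ‖fderiv ℝ g y (EuclideanSpace.single i 1)‖ₑ ≤
      (∫⁻ y, ‖g y‖ₑ ^ 2) ^ (1 / 2 : ℝ) * (∫⁻ y, ‖fderiv ℝ g y‖ₑ ^ 2) ^ (1 / 2 : ℝ) := by
  have hgc : Continuous g := hg.continuous
  have hdi : Continuous fun y => fderiv ℝ g y (EuclideanSpace.single i 1) :=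
    (hg.continuous_fderiv one_ne_zero).clm_apply continuous_const
  have hf : AEMeasurable (fun y => ‖g y‖ₑ) volume := (continuous_enorm.comp hgc).measurable.aemeasurable
  have hd : AEMeasurable (fun y => ‖fderiv ℝ g y (EuclideanSpace.single i 1)‖ₑ) volume :=
    (continuous_enorm.comp hdi).measurable.aemeasurable
  have hH := ENNReal.lintegral_mul_le_Lp_mul_Lq volume Real.HolderConjugate.two_two hf hd
  have hpt : ∀ y, ‖fderiv ℝ g y (EuclideanSpace.single i 1)‖ₑ ≤ ‖fderiv ℝ g y‖ₑ := fun y => by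
    rw [← ofReal_norm, ← ofReal_norm]
    refine ENNReal.ofReal_le_ofReal ?_
    calc ‖fderiv ℝ g y (EuclideanSpace.single i 1)‖ ≤ ‖fderiv ℝ g y‖ * ‖(EuclideanSpace.single i (1 : ℝ) : EuclideanSpace ℝ (Fin 2))‖ :=
          ContinuousLinearMap.le_opNorm _ _
      _ = ‖fderiv ℝ g y‖ := by simp
  calc ∫⁻ y, ‖g y‖ₑ * ‖fderiv ℝ g y (EuclideanSpace.single i 1)‖ₑ
      ≤ (∫⁻ y, ‖g y‖ₑ ^ (2 : ℝ)) ^ (1 / (2 : ℝ)) *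
          (∫⁻ y, ‖fderiv ℝ g y (EuclideanSpace.single i 1)‖ₑ ^ (2 : ℝ)) ^ (1 / (2 : ℝ)) := hH
    _ ≤ (∫⁻ y, ‖g y‖ₑ ^ (2 : ℝ)) ^ (1 / (2 : ℝ)) * (∫⁻ y, ‖fderiv ℝ g y‖ₑ ^ (2 : ℝ)) ^ (1 / (2 : ℝ)) := by
        gcongr with y
        exact hpt y
    _ = _ := by simp_rw [ENNReal.rpow_two]

/-- **Ladyzhenskaya's inequality on `ℝ²`, Cauchy–Schwarz form**: for `g ∈ C¹(ℝ²; F)` with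
`∫ ‖g‖² < ∞`, `∫ ‖g‖⁴ ≤ (∫ ‖g‖²) · (∫ ‖Dg‖²)` (operator norm of the derivative; constant `1`).
[folklore: Ladyzhenskaya 1959, Lemma 1] -/
theorem lintegral_enorm_pow_four_le_lintegral_sq_mul_lintegral_fderiv_sq {g : EuclideanSpace ℝ (Fin 2) → F}
    (hg : ContDiff ℝ 1 g) (hL2 : ∫⁻ y, ‖g y‖ₑ ^ 2 < ∞) :
    ∫⁻ y, ‖g y‖ₑ ^ 4 ≤ (∫⁻ y, ‖g y‖ₑ ^ 2) * ∫⁻ y, ‖fderiv ℝ g y‖ₑ ^ 2 := by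
  have h0 := lintegral_enorm_mul_enorm_fderiv_apply_le hg 0
  have h1 := lintegral_enorm_mul_enorm_fderiv_apply_le hg 1
  have hsq : ((∫⁻ y, ‖g y‖ₑ ^ 2) ^ (1 / 2 : ℝ) * (∫⁻ y, ‖fderiv ℝ g y‖ₑ ^ 2) ^ (1 / 2 : ℝ)) *
      ((∫⁻ y, ‖g y‖ₑ ^ 2) ^ (1 / 2 : ℝ) * (∫⁻ y, ‖fderiv ℝ g y‖ₑ ^ 2) ^ (1 / 2 : ℝ)) =
      (∫⁻ y, ‖g y‖ₑ ^ 2) * ∫⁻ y, ‖fderiv ℝ g y‖ₑ ^ 2 := by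
    rw [mul_mul_mul_comm, ← ENNReal.rpow_add_of_nonneg _ _ (by norm_num) (by norm_num),
      ← ENNReal.rpow_add_of_nonneg _ _ (by norm_num) (by norm_num)]
    norm_num
  calc ∫⁻ y, ‖g y‖ₑ ^ 4 ≤ _ := lintegral_enorm_pow_four_le_lintegral_mul_lintegral hg hL2
    _ ≤ ((∫⁻ y, ‖g y‖ₑ ^ 2) ^ (1 / 2 : ℝ) * (∫⁻ y, ‖fderiv ℝ g y‖ₑ ^ 2) ^ (1 / 2 : ℝ)) *
        ((∫⁻ y, ‖g y‖ₑ ^ 2) ^ (1 / 2 : ℝ) * (∫⁻ y, ‖fderiv ℝ g y‖ₑ ^ 2) ^ (1 / 2 : ℝ)) :=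
        mul_le_mul' h0 h1
    _ = _ := hsq

end TwoDim

/-! ### The plane parametrisation `P(y, c) = (y₀, y₁, c)` of `ℝ³` -/

/-- **The isometric linear part of the plane parametrisation.** There is a continuous linear
`L : ℝ² → ℝ³` with `‖L y‖ = ‖y‖` and `P(y,c) = L y + c e₂` for all `y`, `c`
(`L y = (y₀, y₁, 0)`). -/
theorem exists_planeEmb : ∃ L : EuclideanSpace ℝ (Fin 2) →L[ℝ] EuclideanSpace ℝ (Fin 3),
    (∀ y, ‖L y‖ = ‖y‖) ∧ ∀ (y : EuclideanSpace ℝ (Fin 2)) (c : ℝ),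
      (toLp 2 ![y 0, y 1, c] : EuclideanSpace ℝ (Fin 3)) = L y + c • EuclideanSpace.single 2 1 := by
  set L : EuclideanSpace ℝ (Fin 2) →L[ℝ] EuclideanSpace ℝ (Fin 3) :=
    (EuclideanSpace.proj (0 : Fin 2)).smulRight (EuclideanSpace.single (0 : Fin 3) (1 : ℝ)) +
      (EuclideanSpace.proj (1 : Fin 2)).smulRight (EuclideanSpace.single (1 : Fin 3) (1 : ℝ)) with hL
  have hLy : ∀ y : EuclideanSpace ℝ (Fin 2), L y = toLp 2 ![y 0, y 1, 0] := fun y => by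
    ext k
    fin_cases k <;> simp [hL]
  refine ⟨L, fun y => ?_, fun y c => ?_⟩
  · have h2 : ‖y‖ ^ 2 = y 0 ^ 2 + y 1 ^ 2 := by
      rw [EuclideanSpace.real_norm_sq_eq, Fin.sum_univ_two]
    have h3 : ‖(toLp 2 ![y 0, y 1, (0 : ℝ)] : EuclideanSpace ℝ (Fin 3))‖ ^ 2 = y 0 ^ 2 + y 1 ^ 2 := by
      rw [EuclideanSpace.real_norm_sq_eq, Fin.sum_univ_three]
      simp
    rw [hLy]
    exact (sq_eq_sq₀ (norm_nonneg _) (norm_nonneg _)).1 (by rw [h3, h2])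
  · rw [hLy]
    exact toLp_vec3_eq_add_smul y c

/-- The slice of a `C^n` field along the plane `R({x₂ = c})` is `C^n` in the plane parameter. -/
theorem contDiff_comp_planePt {G : Type*} [NormedAddCommGroup G] [NormedSpace ℝ G] {n : ℕ∞}
    {w : EuclideanSpace ℝ (Fin 3) → G} (hw : ContDiff ℝ n w)
    (R : EuclideanSpace ℝ (Fin 3) ≃ₗᵢ[ℝ] EuclideanSpace ℝ (Fin 3)) (c : ℝ) :
    ContDiff ℝ n fun y : EuclideanSpace ℝ (Fin 2) => w (R (toLp 2 ![y 0, y 1, c])) := by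
  obtain ⟨L, -, hP⟩ := exists_planeEmb
  have hfun : (fun y : EuclideanSpace ℝ (Fin 2) => w (R (toLp 2 ![y 0, y 1, c]))) =
      fun y => w (R (L y + c • EuclideanSpace.single 2 1)) := by
    funext y; rw [hP]
  rw [hfun]
  exact hw.comp (R.contDiff.comp (L.contDiff.add contDiff_const))

/-- **Chain rule on the plane**: the derivative of the slice `y ↦ w(R(P(y,c)))` at `y` is
`Dw(R(P(y,c))) ∘ R ∘ L`, so its operator norm is at most `‖Dw(R(P(y,c)))‖` (`R`, `L` isometric). -/
theorem norm_fderiv_comp_planePt_le {G : Type*} [NormedAddCommGroup G] [NormedSpace ℝ G]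
    {w : EuclideanSpace ℝ (Fin 3) → G} (hw : Differentiable ℝ w)
    (R : EuclideanSpace ℝ (Fin 3) ≃ₗᵢ[ℝ] EuclideanSpace ℝ (Fin 3)) (c : ℝ) (y : EuclideanSpace ℝ (Fin 2)) :
    ‖fderiv ℝ (fun y : EuclideanSpace ℝ (Fin 2) => w (R (toLp 2 ![y 0, y 1, c]))) y‖ ≤
      ‖fderiv ℝ w (R (toLp 2 ![y 0, y 1, c]))‖ := by
  obtain ⟨L, hLn, hP⟩ := exists_planeEmb
  have hfun : (fun y : EuclideanSpace ℝ (Fin 2) => w (R (toLp 2 ![y 0, y 1, c]))) =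
      fun y => w (R (L y + c • EuclideanSpace.single 2 1)) := by
    funext y; rw [hP]
  -- derivative of the affine parametrisation composed with `R`
  have hA : HasFDerivAt (fun y : EuclideanSpace ℝ (Fin 2) => R (L y + c • EuclideanSpace.single 2 1))
      ((R.toContinuousLinearEquiv : EuclideanSpace ℝ (Fin 3) →L[ℝ] EuclideanSpace ℝ (Fin 3)).comp L) y := by
    have h1 : HasFDerivAt (fun y : EuclideanSpace ℝ (Fin 2) => L y + c • EuclideanSpace.single (2 : Fin 3) (1 : ℝ)) L y :=
      L.hasFDerivAt.add_const _
    exact (R.toContinuousLinearEquiv : EuclideanSpace ℝ (Fin 3) →L[ℝ] EuclideanSpace ℝ (Fin 3)).hasFDerivAt.comp y h1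
  have hcomp : HasFDerivAt (fun y : EuclideanSpace ℝ (Fin 2) => w (R (L y + c • EuclideanSpace.single 2 1)))
      ((fderiv ℝ w (R (L y + c • EuclideanSpace.single 2 1))).comp
        ((R.toContinuousLinearEquiv : EuclideanSpace ℝ (Fin 3) →L[ℝ] EuclideanSpace ℝ (Fin 3)).comp L)) y :=
    (hw _).hasFDerivAt.comp y hA
  rw [hfun, hcomp.fderiv, ← hP]
  refine (ContinuousLinearMap.opNorm_comp_le _ _).trans ?_
  have hRL : ‖(R.toContinuousLinearEquiv : EuclideanSpace ℝ (Fin 3) →L[ℝ] EuclideanSpace ℝ (Fin 3)).comp L‖ ≤ 1 := by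
    refine ContinuousLinearMap.opNorm_le_bound _ zero_le_one fun v => ?_
    rw [one_mul, ContinuousLinearMap.comp_apply]
    change ‖R (L v)‖ ≤ ‖v‖
    rw [LinearIsometryEquiv.norm_map, hLn]
  calc ‖fderiv ℝ w (R (toLp 2 ![y 0, y 1, c]))‖ *
        ‖(R.toContinuousLinearEquiv : EuclideanSpace ℝ (Fin 3) →L[ℝ] EuclideanSpace ℝ (Fin 3)).comp L‖
      ≤ ‖fderiv ℝ w (R (toLp 2 ![y 0, y 1, c]))‖ * 1 := by gcongr
    _ = _ := mul_one _

/-- **Tonelli along the foliation, offsets outside.** For measurable `f : ℝ³ → ℝ≥0∞` and a linear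
isometry `R`: `∫_{ℝ³} f = ∫_{c ∈ ℝ} ∫_{y ∈ ℝ²} f(R(y₀,y₁,c))`. -/
theorem lintegral_eq_lintegral_lintegral_plane {f : EuclideanSpace ℝ (Fin 3) → ℝ≥0∞} (hf : Measurable f)
    (R : EuclideanSpace ℝ (Fin 3) ≃ₗᵢ[ℝ] EuclideanSpace ℝ (Fin 3)) :
    ∫⁻ x, f x = ∫⁻ c : ℝ, ∫⁻ y : EuclideanSpace ℝ (Fin 2), f (R (toLp 2 ![y 0, y 1, c])) := by
  obtain ⟨e, he, heq⟩ := exists_slabChart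
  have hm : Measurable fun z : ℝ × EuclideanSpace ℝ (Fin 2) => f (R (e z)) :=
    hf.comp (R.continuous.measurable.comp e.measurable)
  calc ∫⁻ x, f x = ∫⁻ x, f (R x) := (R.measurePreserving.lintegral_comp hf).symm
    _ = ∫⁻ z, f (R (e z)) := (he.lintegral_comp (hf.comp R.continuous.measurable)).symm
    _ = ∫⁻ z, f (R (e z)) ∂((volume : Measure ℝ).prod (volume : Measure (EuclideanSpace ℝ (Fin 2)))) := by
        rw [Measure.volume_eq_prod]
    _ = ∫⁻ c : ℝ, ∫⁻ y : EuclideanSpace ℝ (Fin 2), f (R (e (c, y))) := lintegral_prod _ hm.aemeasurable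
    _ = ∫⁻ c : ℝ, ∫⁻ y : EuclideanSpace ℝ (Fin 2), f (R (toLp 2 ![y 0, y 1, c])) := by
        simp only [heq]

/-- Measurability in the offset of the planar integrals `c ↦ ∫_{ℝ²} f(R(y₀,y₁,c)) dy`. -/
theorem measurable_lintegral_plane {f : EuclideanSpace ℝ (Fin 3) → ℝ≥0∞} (hf : Measurable f)
    (R : EuclideanSpace ℝ (Fin 3) ≃ₗᵢ[ℝ] EuclideanSpace ℝ (Fin 3)) :
    Measurable fun c : ℝ => ∫⁻ y : EuclideanSpace ℝ (Fin 2), f (R (toLp 2 ![y 0, y 1, c])) := by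
  obtain ⟨e, -, heq⟩ := exists_slabChart
  have hm : Measurable fun z : ℝ × EuclideanSpace ℝ (Fin 2) => f (R (e z)) :=
    hf.comp (R.continuous.measurable.comp e.measurable)
  have hfun : (fun c : ℝ => ∫⁻ y : EuclideanSpace ℝ (Fin 2), f (R (toLp 2 ![y 0, y 1, c]))) =
      fun c => ∫⁻ y : EuclideanSpace ℝ (Fin 2), (fun z : ℝ × EuclideanSpace ℝ (Fin 2) => f (R (e z))) (c, y) := by
    simp only [heq]
  rw [hfun]
  exact hm.lintegral_prod_right'

/-! ### The slice-wise Ladyzhenskaya inequality on `ℝ³` -/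

section ThreeDim

variable {F : Type*} [NormedAddCommGroup F] [InnerProductSpace ℝ F]

/-- **Slice-wise Ladyzhenskaya inequality** (section form). For a `C¹` field `w : ℝ³ → F` with
`∫ ‖w‖² < ∞` and every linear isometry `R`:
`∫_{ℝ³} ‖w‖⁴ ≤ (sup_c ∫_{ℝ²} ‖w(R(y₀,y₁,c))‖² dy) · ∫_{ℝ³} ‖Dw‖²` — the `L⁴` norm is controlled by
the planar ceiling in ONE direction and the gradient. (Planar Ladyzhenskaya on almost every
plane of the foliation, `‖D(w∘R∘P(·,c))‖ ≤ ‖Dw‖`, Tonelli in the offset.) [folklore] -/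
theorem lintegral_enorm_pow_four_le_iSup_planarEnergy_mul' {w : EuclideanSpace ℝ (Fin 3) → F}
    (hw : ContDiff ℝ 1 w) (hL2 : ∫⁻ x, ‖w x‖ₑ ^ 2 < ∞)
    (R : EuclideanSpace ℝ (Fin 3) ≃ₗᵢ[ℝ] EuclideanSpace ℝ (Fin 3)) :
    ∫⁻ x, ‖w x‖ₑ ^ 4 ≤
      (⨆ c : ℝ, ∫⁻ y : EuclideanSpace ℝ (Fin 2), ‖w (R (toLp 2 ![y 0, y 1, c]))‖ₑ ^ 2) *
        ∫⁻ x, ‖fderiv ℝ w x‖ₑ ^ 2 := by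
  have hwc : Continuous w := hw.continuous
  have hdiff : Differentiable ℝ w := hw.differentiable one_ne_zero
  have hm2 : Measurable fun x => ‖w x‖ₑ ^ 2 := (continuous_enorm.comp hwc).measurable.pow_const 2
  have hm4 : Measurable fun x => ‖w x‖ₑ ^ 4 := (continuous_enorm.comp hwc).measurable.pow_const 4
  have hmD : Measurable fun x => ‖fderiv ℝ w x‖ₑ ^ 2 :=
    (continuous_enorm.comp (hw.continuous_fderiv one_ne_zero)).measurable.pow_const 2
  set P : ℝ≥0∞ := ⨆ c : ℝ, ∫⁻ y : EuclideanSpace ℝ (Fin 2), ‖w (R (toLp 2 ![y 0, y 1, c]))‖ₑ ^ 2 with hP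
  -- almost every plane has finite planar energy
  have hae : ∀ᵐ c : ℝ, ∫⁻ y : EuclideanSpace ℝ (Fin 2), ‖w (R (toLp 2 ![y 0, y 1, c]))‖ₑ ^ 2 < ∞ := by
    refine ae_lt_top (measurable_lintegral_plane hm2 R) ?_
    rw [← lintegral_eq_lintegral_lintegral_plane hm2 R]
    exact hL2.ne
  -- the planar inequality on such a plane
  have hplane : ∀ c, ∫⁻ y : EuclideanSpace ℝ (Fin 2), ‖w (R (toLp 2 ![y 0, y 1, c]))‖ₑ ^ 2 < ∞ →
      ∫⁻ y : EuclideanSpace ℝ (Fin 2), ‖w (R (toLp 2 ![y 0, y 1, c]))‖ₑ ^ 4 ≤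
        P * ∫⁻ y : EuclideanSpace ℝ (Fin 2), ‖fderiv ℝ w (R (toLp 2 ![y 0, y 1, c]))‖ₑ ^ 2 := by
    intro c hc
    have hg : ContDiff ℝ 1 fun y : EuclideanSpace ℝ (Fin 2) => w (R (toLp 2 ![y 0, y 1, c])) :=
      contDiff_comp_planePt hw R c
    have h1 := lintegral_enorm_pow_four_le_lintegral_sq_mul_lintegral_fderiv_sq hg hc
    refine h1.trans (mul_le_mul' (le_iSup (fun c : ℝ => ∫⁻ y : EuclideanSpace ℝ (Fin 2),
      ‖w (R (toLp 2 ![y 0, y 1, c]))‖ₑ ^ 2) c) (lintegral_mono fun y => ?_))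
    gcongr
    rw [← ofReal_norm, ← ofReal_norm]
    exact ENNReal.ofReal_le_ofReal (norm_fderiv_comp_planePt_le hdiff R c y)
  calc ∫⁻ x, ‖w x‖ₑ ^ 4
      = ∫⁻ c : ℝ, ∫⁻ y : EuclideanSpace ℝ (Fin 2), ‖w (R (toLp 2 ![y 0, y 1, c]))‖ₑ ^ 4 :=
        lintegral_eq_lintegral_lintegral_plane hm4 R
    _ ≤ ∫⁻ c : ℝ, P * ∫⁻ y : EuclideanSpace ℝ (Fin 2), ‖fderiv ℝ w (R (toLp 2 ![y 0, y 1, c]))‖ₑ ^ 2 := by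
        refine lintegral_mono_ae ?_
        filter_upwards [hae] with c hc
        exact hplane c hc
    _ = P * ∫⁻ c : ℝ, ∫⁻ y : EuclideanSpace ℝ (Fin 2), ‖fderiv ℝ w (R (toLp 2 ![y 0, y 1, c]))‖ₑ ^ 2 :=
        lintegral_const_mul P (measurable_lintegral_plane hmD R)
    _ = P * ∫⁻ x, ‖fderiv ℝ w x‖ₑ ^ 2 := by rw [← lintegral_eq_lintegral_lintegral_plane hmD R]

end ThreeDim

/-- **Slice-wise Ladyzhenskaya inequality** (registered form, sub-goal
`lintegral_enorm_pow_four_le_iSup_planarEnergy_mul` of stmt-NavierStokesRegularity-16855): for every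
real inner product space `F`, every `C¹` field `w : ℝ³ → F` with `∫ ‖w‖² < ∞` and every linear
isometry `R` of `ℝ³`,
`∫ ‖w‖⁴ ≤ (sup_c ∫_{ℝ²} ‖w(R(y₀,y₁,c))‖² dy) · ∫ ‖Dw‖²`.
This is the first input of the flux-variation bound of the slab-law line `birth` (strategist
census gen 1, A-S6 (F1)): `‖u‖²_{L⁴} ≤ √(P_R · Z)` with `P_R` the planar ceiling in the direction
`R` and `Z = ‖Du‖₂²`. [folklore: Ladyzhenskaya 1959, Lemma 1, slice-wise] -/
theorem lintegral_enorm_pow_four_le_iSup_planarEnergy_mul : ∀ {F : Type*} [NormedAddCommGroup F] [InnerProductSpace ℝ F] {w : EuclideanSpace ℝ (Fin 3) → F}, ContDiff ℝ 1 w → ∫⁻ x, ‖w x‖ₑ ^ 2 < ⊤ → ∀ (R : EuclideanSpace ℝ (Fin 3) ≃ₗᵢ[ℝ] EuclideanSpace ℝ (Fin 3)), ∫⁻ x, ‖w x‖ₑ ^ 4 ≤ (⨆ c : ℝ, ∫⁻ y : EuclideanSpace ℝ (Fin 2), ‖w (R (WithLp.toLp 2 ![y 0, y 1, c]))‖ₑ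 ^ 2) * ∫⁻ x, ‖fderiv ℝ w x‖ₑ ^ 2 :=
  fun hw hL2 R => lintegral_enorm_pow_four_le_iSup_planarEnergy_mul' hw hL2 R

end Summit.NavierStokesRegularity.NavierStokesRegularity.Theorems.PlanarEnergyAPriori

end
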